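import Summits.BirchSwinnertonDyer.BirchSwinnertonDyer.Theorems.SmallImageMuTransferMuTransferX9CoresUnramifiedAt
import Summits.BirchSwinnertonDyer.BirchSwinnertonDyer.Theorems.SmallImageMuTransferMuTransferX9KolyvaginClassTwistUnramified
import Summits.BirchSwinnertonDyer.BirchSwinnertonDyer.Theorems.SmallImageMuTransferMuTransferX9StepFourCocycleSeams
import Literature.NumberTheory.EllipticCurves.Kato2004.EulerSystemClasses
import Literature.NumberTheory.EllipticCurves.Kato2004.IwasawaH1ReductionTower
import Literature.NumberTheory.EllipticCurves.Kato2004.IntegralH1Corestriction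
import Literature.NumberTheory.EllipticCurves.Kato2004.IwasawaCohomologyZetaLift
import HarnessLib

/-!
# K6 crux `MuTransferX9` (stmt-BirchSwinnertonDyer-19276), skeleton v6/v6d stub
# `stub_stepsTwoFourOdd`:
# the Euler-system tower class `𝐳̄₁ = (I.redTower s)_J` is UNRAMIFIED AT EVERY `q ∤ p` where `E[p]`
# is
# unramified — clause (I0) of the assembler's hypothesis `hTame`

Cell `b2b-bsdres`, seat `x10` GEN 39 (N2 = X10b@3 class lead, serving the K6 route
`SmallImageMuTransfer` of cell `bsd-smallim`; bsd-smallim STATUS l.335 (lur-b's frozen `hTame`,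
clause (I0)) and l.342 (x10 TAKING (I0))).  THEOREMS ONLY (no definition, no named fact, no
`sorry`).  HONEST FRAMING: helper toward the registered stub `stub_stepsTwoFourOdd` of crux 19276;
closes nothing; nothing is booked; class X10b stays CONSTRUCTION-SHAPED / NEEDS X_A3 and class X9
TYPED. PARTITION (D-0054): X9 (A4) × p ∈ {5, 7} · X10b∧¬Surj (A5) × p = 3 — helper; closes NONE.

## What

For a GENUINE Λ-adic Euler-system class `s` (`Kato2004.IsEulerSystemClass W p κ γ I s`: Kato's
classes are integral, `z_{k,r} ∈ H¹(ℤ[ζ, 1/p], T)`, tree `integralH1`), the `Ω`-adic class `𝐳̄₁ =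
I.redTower s ∈ lim←_J H¹(ℚ, 𝒯_J(E))` (k6-ty `Kato2004.IwasawaH1Data.redTower`: `(𝐳̄₁)_J = trunc
(Sh_J⁻¹ (red (proj_J s)))`) is UNRAMIFIED at every finite place `q` with `q ∤ p` at which `E[p]` is
unramified:

* `proj_mem_integralH1` — `proj_n s = Cor (z_{n+1,∅}) ∈ H¹(ℤ_{ℚ_n}[1/p], T_pW)` (tree
  `Kato2004.coresLe_mem_integralH1`; `ℚ(μ_{p^{n+1}})` is unramified away from `p`);
* `exists_cocycle_reduceH1_proj_apply_eq_zero` — a cocycle of `red (proj_n s) ∈ H¹(ℚ_n, E[p])`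
  vanishing on `Γ_n ∩ I_𝔓` for every `𝔓 ∣ q` (`reduceH1_mem_integralH1` + class ↦ pointwise, the
  inertia acting trivially on `E[p]`);
* **`localization_redTower_mem_unramifiedSubgroup`** — `loc_q ((I.redTower s).1 J) ∈ H¹_ur(ℚ_q,
  𝒯_J)` for every `J` (x9
  `CoresUnramified.exists_cocycle_coresShapiro_apply_eq_zero_of_forall_primesAbove` for the Shapiro
  step, truncation on cocycles, k6-g3
  `localization_mem_unramifiedSubgroup_of_forall_inertia_apply_eq_zero`) — clause (I0) of `hTame`
  VERBATIM at `J = 2e'+2` (`W.modPTwist p κ J` is `κ.twistModP (W.torsionGaloisModule p) _ J` by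
  `rfl`);
* `forall_absInertia_apply_eq_zero_of_oneCocycleClass_eq_redTower` — pointwise form for ANY cocycle
  `Φ'` of `(I.redTower s)_J` (e.g. the stub's `S^a ∘ Φ`): `Φ'(res i) = 0` for `i ∈ I_{ℚ_q}` — the
  hypothesis `hΦI` of x9's pair transport `exists_forall_convCoeff_aeval_eq_zero_of_isAbsArithFrob`
  (p455870).

References: K. Kato, Astérisque 295 (2004) (8.1.3), §8.2, Lemma 8.5, §13.8 [Kato2004Asterisque]; J.
Neukirch, A. Schmidt, K. Wingberg, *Cohomology of Number Fields* (2008) (1.5.7)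
[NeukirchSchmidtWingberg2008]; J.-P. Serre, *Galois Cohomology* (1997) I §2.5
[SerreGaloisCohomology1997].
-/

-- the summit and its single problem are both named `BirchSwinnertonDyer` (registry layout D-0017)
set_option linter.dupNamespace false
set_option autoImplicit false

noncomputable section

open CategoryTheory Function
open scoped NumberField Pointwise
open Field IsDedekindDomain NumberField
open Literature.NumberTheory.GaloisRepresentations
open Literature.NumberTheory.GaloisRepresentations.IsNonarchimedeanLocalField
open Literature.NumberTheory.EllipticCurves
open Literature.NumberTheory.EllipticCurves.ZpExtension
open Literature.NumberTheory.EllipticCurves.Kato2004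
open Literature.NumberTheory.EllipticCurves.Kato2004.EulerSystemValues
open Rat.HeightOneSpectrum

namespace Summit.BirchSwinnertonDyer.BirchSwinnertonDyer.Rank1Residual.RedTower

variable (W : WeierstrassCurve ℚ) [W.IsElliptic] (p : ℕ) [Fact p.Prime]
  [ContinuousSMul ℤ_[p] (W.tateModule p)]
  [Module.Free ℤ_[p] (W.tateModule p)] [Module.Finite ℤ_[p] (W.tateModule p)]
  (κ : ZpExtension ℚ p) (γ : absoluteGaloisGroup ℚ) (I : IwasawaH1Data W p κ γ)

/-- **The layer components of a genuine Euler-system class are integral**: `proj_n s =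
Cor_{ℚ(μ_{p^{n+1}}) → ℚ_n} (z_{n+1,∅})` lies in `H¹(ℤ_{ℚ_n}[1/p], T_pW) = integralH1` (Kato (8.1.3):
the classes `z` are integral; the trace keeps integrality, tree `Kato2004.coresLe_mem_integralH1`,
since `ℚ(μ_{p^{n+1}})/ℚ` is unramified away from `p`). [cite: Kato2004Asterisque, (8.1.3), §8.2 and
Lemma 8.5 (pp. 180–184)] -/
theorem proj_mem_integralH1 {s : I.H} (hES : IsEulerSystemClass W p κ γ I s) (n : ℕ) :
    I.proj n s ∈ integralH1 (tateRep W p) p (κ.layerSubgroup n) := by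
  obtain ⟨S, hS, z, -, hint, h, hproj⟩ := hES
  rw [hproj n]
  haveI := normal_cyclotomicLevelsRat_level_empty p S (n + 1)
  haveI : ((cyclotomicLevelsRat p S).level (n + 1) ∅).FiniteIndex :=
    finiteIndex_of_isOpen_of_compactSpace _ ((cyclotomicLevelsRat p S).isOpen_level (n + 1) ∅)
  letI : Fintype (κ.layerSubgroup n ⧸
      ((cyclotomicLevelsRat p S).level (n + 1) ∅).subgroupOf (κ.layerSubgroup n)) :=
    Fintype.ofFinite _
  have key := Kato2004.coresLe_mem_integralH1 (tateRep W p) p (h n)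
    ((cyclotomicLevelsRat p S).isOpen_level (n + 1) ∅)
    (cyclotomicLevelsRat_level_empty_unramifiedAt p S (n + 1))
    (hint (n + 1) (cyclotomicLevelsRat p S).idealOne)
  convert key using 2
  delta coresToLayer
  rfl

/-- **A cocycle of `red (proj_n s) ∈ H¹(ℚ_n, E[p])` vanishing on `Γ_n ∩ I_𝔓` for every `𝔓 ∣ q`**, `q ∤
p`, `E[p]` unramified at `q`: the reduction of an integral class is integral
(`reduceH1_mem_integralH1`), and a class vanishing on `Γ_n ∩ I_𝔓` with `I_𝔓` acting trivially on
`E[p]` has every cocycle vanishing there (k6-g3 `apply_eq_zero_of_resLe_inf_eq_zero`). [cite: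
Kato2004Asterisque, §8.2 and Lemma 8.5 (pp. 180–184)] -/
theorem exists_cocycle_reduceH1_proj_apply_eq_zero {s : I.H} (hES : IsEulerSystemClass W p κ γ I s)
    (n : ℕ) {q : HeightOneSpectrum (𝓞 ℚ)} (hqp : (p : 𝓞 ℚ) ∉ q.asIdeal)
    (hur : GaloisRep.IsUnramifiedAt q (W.torsionGaloisModule (p : ℤ))) :
    ∃ f : contOneCocycles
        (subgroupRep (W.torsionGaloisModule (p : ℤ)).toTopRep (κ.layerSubgroup n)),
      oneCocycleClass _ f = reduceH1 W p (κ.layerSubgroup n) (I.proj n s) ∧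
      ∀ 𝔓 ∈ q.primesAbove, ∀ g : κ.layerSubgroup n,
        (g : absoluteGaloisGroup ℚ) ∈ 𝔓.inertia (absoluteGaloisGroup ℚ) → f.1 g = 0 := by
  have hint := reduceH1_mem_integralH1 W p (κ.layerSubgroup n) (proj_mem_integralH1 W p κ γ I hES n)
  obtain ⟨f, hf⟩ := oneCocycleClass_surjective _ (reduceH1 W p (κ.layerSubgroup n) (I.proj n s))
  refine ⟨f, hf, fun 𝔓 h𝔓 g hg => ?_⟩
  have hne : ((primesEquiv q : Nat.Primes) : ℕ) ≠ p := by
    intro h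
    apply hqp
    rw [Rat.natCast_mem_asIdeal_iff, ← h]
    exact dvd_rfl
  have hres := (mem_integralH1_iff _ p _ _).1 hint q hne 𝔓 h𝔓
  rw [← hf] at hres
  have hI : ∀ τ ∈ 𝔓.inertia (absoluteGaloisGroup ℚ), ∀ w : (W.torsionGaloisModule (p : ℤ)).toTopRep,
      (W.torsionGaloisModule (p : ℤ)).toTopRep.ρ τ w = w := fun τ hτ w => by
    change (W.torsionGaloisModule (p : ℤ)) τ w = w
    rw [hur 𝔓 h𝔓 τ hτ]
    rfl
  exact KolyvaginTwist.apply_eq_zero_of_resLe_inf_eq_zero _ _ (𝔓.inertia (absoluteGaloisGroup ℚ)) hI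
    f hres g hg

/-- **(I0) — the Euler-system tower class is unramified at `q`.**  For a genuine Λ-adic Euler-system
class `s`, every level `J` and every finite place `q ∤ p` where `E[p]` is unramified: `loc_q
((I.redTower s)_J) ∈ H¹_ur(ℚ_q, 𝒯_J(E))`.  Proof: `(I.redTower s)_J = trunc (Sh_J⁻¹ (red (proj_J
s)))`; `red (proj_J s)` has a cocycle vanishing on every `Γ_J ∩ I_𝔓`, `𝔓 ∣ q`; the inverse Shapiro
map keeps a cocycle vanishing on every `I_𝔓` (x9
`exists_cocycle_coresShapiro_apply_eq_zero_of_forall_primesAbove`); truncation acts on cocycles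
valuewise; a global cocycle vanishing on `I_{𝔓₀}` has unramified localisation (k6-g3).  Clause (I0)
of the assembler's `hTame` at `J = 2e'+2`. [cite: Kato2004Asterisque, (8.1.3) and §13.8 (pp.
228–229)] [cite: SerreGaloisCohomology1997, I §2.5 Prop. 10] -/
theorem localization_redTower_mem_unramifiedSubgroup {s : I.H}
    (hES : IsEulerSystemClass W p κ γ I s)
    {q : HeightOneSpectrum (𝓞 ℚ)} (hqp : (p : 𝓞 ℚ) ∉ q.asIdeal)
    (hur : GaloisRep.IsUnramifiedAt q (W.torsionGaloisModule (p : ℤ))) (J : ℕ) :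
    galoisCohomology.localization (W.modPTwist p κ J) (Sum.inr q) 1
        ((I.redTower s : ∀ J : ℕ, galoisCohomology (κ.twistModP (W.torsionGaloisModule (p : ℤ))
          IwasawaH1Data.torsion_nsmul_eq_zero J) 1) J) ∈
      DiscreteGaloisModule.unramifiedSubgroup (GaloisRep.toLocal q (W.modPTwist p κ J)) 1 := by
  letI := κ.fintypeQuotientLayer J
  -- the layer class and its unramified cocycle
  obtain ⟨f, hf, hf0⟩ := exists_cocycle_reduceH1_proj_apply_eq_zero W p κ γ I hES J hqp hur
  -- the inverse Shapiro map keeps a cocycle vanishing on every `I_𝔓`, `𝔓 ∣ q`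
  obtain ⟨F, hF, hF0⟩ :=
    CoresUnramified.exists_cocycle_coresShapiro_apply_eq_zero_of_forall_primesAbove κ
      (W.torsionGaloisModule (p : ℤ)) IwasawaH1Data.torsion_nsmul_eq_zero J hqp f hf0
  -- `(I.redTower s)_J = trunc [F]`
  have hJ : J ≤ p ^ J := (Nat.lt_pow_self (Fact.out : p.Prime).one_lt).le
  have hred : (I.redTower s : ∀ J : ℕ, galoisCohomology (κ.twistModP (W.torsionGaloisModule (p : ℤ))
      IwasawaH1Data.torsion_nsmul_eq_zero J) 1) J =
      oneCocycleClass _ (κ.pushCocycle (W.torsionGaloisModule (p : ℤ))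
        IwasawaH1Data.torsion_nsmul_eq_zero (p ^ J)
        (κ.twistModPTruncate (W.torsionGaloisModule (p : ℤ)) IwasawaH1Data.torsion_nsmul_eq_zero
          (p ^ J) hJ) F) := by
    rw [IwasawaH1Data.redTower_apply_coe, ← hf, ← hF]
    exact map_oneCocycleClass_twist κ _ _ _ _ F
  rw [hred]
  -- the truncated cocycle vanishes on `I_{𝔓₀}`
  exact KolyvaginTwist.localization_mem_unramifiedSubgroup_of_forall_inertia_apply_eq_zero
    (W.modPTwist p κ J) q _ fun τ hτ => by
      rw [pushCocycle_apply, hF0 _ (adicCompletionPrime_mem_primesAbove ℚ q) τ hτ, map_zero]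

/-- **Pointwise form for any cocycle of `(I.redTower s)_J`** (the stub's `Φ' = S^a ∘ Φ`, x9 STATUS
l.288): such a cocycle vanishes on the restricted local inertia `res(I_{ℚ_q})`, since its class is
unramified at `q` ((I0)) and `I_{ℚ_q}` acts trivially on `𝒯_J(E)` (`E[p]` unramified, `q ∤ p`) — the
hypothesis `hΦI` of x9's pair transport `exists_forall_convCoeff_aeval_eq_zero_of_isAbsArithFrob`.
[cite: Kato2004Asterisque, (8.1.3) and §13.8 (pp. 228–229)] [cite: SerreGaloisCohomology1997, I §2.5
Prop. 10] -/
theorem forall_absInertia_apply_eq_zero_of_oneCocycleClass_eq_redTower {s : I.H}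
    (hES : IsEulerSystemClass W p κ γ I s) {q : HeightOneSpectrum (𝓞 ℚ)}
    (hqp : (p : 𝓞 ℚ) ∉ q.asIdeal) (hur : GaloisRep.IsUnramifiedAt q (W.torsionGaloisModule (p : ℤ)))
    (J : ℕ) (Φ' : contOneCocycles (W.modPTwist p κ J).toTopRep)
    (hΦ' : oneCocycleClass (W.modPTwist p κ J).toTopRep Φ' =
      (I.redTower s : ∀ J : ℕ, galoisCohomology (κ.twistModP (W.torsionGaloisModule (p : ℤ))
        IwasawaH1Data.torsion_nsmul_eq_zero J) 1) J) :
    ∀ i ∈ absInertia (q.adicCompletion ℚ),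
      Φ'.1 (absGaloisRestrict ℚ (q.adicCompletion ℚ) i) = 0 := by
  have hmem := localization_redTower_mem_unramifiedSubgroup W p κ γ I hES hqp hur J
  rw [← hΦ'] at hmem
  exact fun i hi => StepFour.apply_absGaloisRestrict_eq_zero_of_localization_mem_unramified κ
    (W.torsionGaloisModule (p : ℤ)) (fun P => AddSubgroup.torsionBy.nsmul P) J q hur hqp Φ' hmem hi

end Summit.BirchSwinnertonDyer.BirchSwinnertonDyer.Rank1Residual.RedTower

end
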